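import Literature.MathematicalPhysics.QuantumFieldTheory.ConformalBootstrap3D.PointKernelK57Data
import Literature.MathematicalPhysics.QuantumFieldTheory.ConformalBootstrap3D.PointKernelParts

/-!
# K57 certificate, kernel part file P16: one-cell head segments 153, 154 in level ranges

The head cells whose kernel evaluation exceeds one `decide` are one-cell segments of `hsegsK57`; each is
checked by `PCert.hPartSideOK` (side conditions) and `PCert.hPartOK` per level range `[n_lo, n_lo + count)`
against an integer claim, the claims summing to `≥ 0` (`PointKernel.partsOK`); soundness is
`PCert.hParts_sound` (`PointKernelParts`).  The part files `P1, P2, …` are mutually independent (each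
imports only the data file); the ranges of one cell may span several of them, and the per-cell
conclusions `hparts_i` / `hcell_i` of those cells are assembled in `PointKernelK57.lean`.
Estimated kernel time 198 s.
-/

set_option maxRecDepth 100000
set_option maxHeartbeats 0

namespace Literature.MathematicalPhysics.QuantumFieldTheory.ConformalBootstrap3D.PointKernelK57

open Literature.MathematicalPhysics.QuantumFieldTheory.ConformalBootstrap3D.PointKernel

/-- one-cell segment 153 (row 6, cell `[449/64, 1797/256]`, chord, `n_F = 40`,
3 level ranges): side conditions. [folklore] -/
theorem pside_153 : certK57.hPartSideOK (PCert.segAt hsegsK57 153) JHK57 = true := by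
  decide +kernel

/-- its level ranges `(n_lo, count, claim)`. [folklore] -/
def parts_153 : List (ℕ × ℕ × ℤ) := [(0, 27, -8398973890009889468093554996362965059), (27, 12, 7872226365749532591669391574289326712), (39, 2, 526747524260356876424163422073638349)]

/-- the ranges tile `[0, n_F]` and the claims sum to `≥ 0`. [folklore] -/
theorem pcov_153 : PointKernel.partsOK 40 parts_153 = true := by
  decide +kernel

/-- levels `[0, 27)` of segment 153: partial lower sum `≥` claim. [folklore] -/
theorem part_153_0 : certK57.hPartOK (PCert.segAt hsegsK57 153) JHK57 0 27 (-8398973890009889468093554996362965059) = true := by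
  decide +kernel

/-- levels `[27, 39)` of segment 153: partial lower sum `≥` claim. [folklore] -/
theorem part_153_1 : certK57.hPartOK (PCert.segAt hsegsK57 153) JHK57 27 12 (7872226365749532591669391574289326712) = true := by
  decide +kernel

/-- levels `[39, 41)` of segment 153: partial lower sum `≥` claim. [folklore] -/
theorem part_153_2 : certK57.hPartOK (PCert.segAt hsegsK57 153) JHK57 39 2 (526747524260356876424163422073638349) = true := by
  decide +kernel

/-- one-cell segment 154 (row 6, cell `[1797/256, 899/128]`, chord, `n_F = 40`,
3 level ranges): side conditions. [folklore] -/
theorem pside_154 : certK57.hPartSideOK (PCert.segAt hsegsK57 154) JHK57 = true := by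
  decide +kernel

/-- its level ranges `(n_lo, count, claim)`. [folklore] -/
def parts_154 : List (ℕ × ℕ × ℤ) := [(0, 27, -7698816370152441391265337121263447570), (27, 12, 7531902337632843494427565009094831744), (39, 2, 166914032519597896837772112168615827)]

/-- the ranges tile `[0, n_F]` and the claims sum to `≥ 0`. [folklore] -/
theorem pcov_154 : PointKernel.partsOK 40 parts_154 = true := by
  decide +kernel

/-- levels `[0, 27)` of segment 154: partial lower sum `≥` claim. [folklore] -/
theorem part_154_0 : certK57.hPartOK (PCert.segAt hsegsK57 154) JHK57 0 27 (-7698816370152441391265337121263447570) = true := by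
  decide +kernel

end Literature.MathematicalPhysics.QuantumFieldTheory.ConformalBootstrap3D.PointKernelK57
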